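import Mathlib
import Summits.Ventures.PercRepro.TriangleCapMantelStabilityLemmas

/-!
# PercRepro — MANTEL'S DEGREE-SUM LEMMA IS STABLE: a triangle-free graph that is not complete bipartite
spanning has `Σ_v d(v)² ≤ m·k − (k − 2)` (p3, gen 34; part 30b)

TriangleCapCherryMantel gives `Σ_v d(v)² ≤ m·k` on triangle-free graphs with equality on `K_{a,k−a}`;
TriangleCapDenseEquality shows (for `K₄⁻`-free graphs on `k ≥ 7` vertices) that equality holds ONLY on the
complete bipartite spanning graphs.  This module quantifies the gap on triangle-free graphs, for every `k`:

* **`two_mul_le_sum_deficit`** — for an edge `u v` of a triangle-free graph that is not complete bipartite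
  spanning, the ordered deficits sum to at least `2 (k − 2)`;
* **`mantel_stability`** — `Σ_v d(v)² + (k − 2) ≤ m·k` for every triangle-free graph that is not complete
  bipartite spanning (`mantel_stability_cherries`: `2·Σ_v C(d(v), 2) + 2m + (k − 2) ≤ m·k`).

The gap `k − 2` is attained (`K_{a,b}` minus an edge; the star `K_{1,k−2}` plus an isolated vertex), so the
constant is sharp.  The proof fixes an edge `u v` and splits the vertices into `X = N(v)`, `Y = N(u)` (disjoint
and independent) and the rest `Z`.  The deficit of an adjacent pair `(x, y) ∈ X × Y` contains `X ∖ N(y)`,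
`Y ∖ N(x)` and `Z ∖ (N(x) ∪ N(y))`.  If some `x₀ ∈ X`, `y₀ ∈ Y` are non-adjacent, the pairs `(x, y₀)` with
`x ~ y₀` contribute `t (|X| − t) ≥ |X| − 1` through `X ∖ N(y₀)` (`1 ≤ t ≤ |X| − 1`), the pairs `(x₀, y)`
contribute `≥ |Y| − 1`, and the pair `(u, v)` contributes `|Z|` — `k − 2` in all.  If every `X`–`Y` pair is
adjacent, a vertex `z ∈ Z` has neighbours on at most one side (a neighbour on each side would close a
triangle), say `t < |X|` of them in `X` and none in `Y`; then `z` is far from the `(|X| − t)·|Y|` edges of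
`X ∖ N(z)` to `Y`, and `u` is far from the `t` edges of `z`, so `z` accounts for `≥ |X| + |Y| − 1 ≥ k − 2`
pairs; if `Z` is empty too, the graph is `K_{X, Y}`.  Axioms: standard.
-/

namespace PercRepro

namespace TriangleCap

namespace C047

open Finset

variable {V : Type*} [Fintype V] [DecidableEq V]

/-- **THE DEFICITS OF A TRIANGLE-FREE GRAPH THAT IS NOT COMPLETE BIPARTITE SPANNING SUM TO `≥ 2 (k − 2)`**
(ordered pairs), given an edge `u v`. -/
theorem two_mul_le_sum_deficit (D : SimpleGraph V) [DecidableRel D.Adj] (hfree : D.CliqueFree 3)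
    {u v : V} (huv : D.Adj u v)
    (hnot : ¬ ∃ A : Finset V, ∀ x y, D.Adj x y ↔ Xor (x ∈ A) (y ∈ A)) :
    2 * (Fintype.card V - 2) ≤ ∑ p ∈ adjPairsAll D, deficit D p := by
  -- no triangles
  have htri : ∀ a b c, D.Adj a b → D.Adj a c → D.Adj b c → False := fun a b c hab hac hbc =>
    hfree {a, b, c} (SimpleGraph.is3Clique_triple_iff.mpr ⟨hab, hac, hbc⟩)
  -- the three classes of vertices, as opaque sets with their membership rules
  obtain ⟨X, hX⟩ : ∃ X : Finset V, X = univ.filter (fun w => D.Adj v w) := ⟨_, rfl⟩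
  obtain ⟨Y, hY⟩ : ∃ Y : Finset V, Y = univ.filter (fun w => D.Adj u w) := ⟨_, rfl⟩
  obtain ⟨Z, hZ⟩ : ∃ Z : Finset V, Z = univ.filter (fun w => ¬ D.Adj v w ∧ ¬ D.Adj u w) := ⟨_, rfl⟩
  have memX : ∀ w, w ∈ X ↔ D.Adj v w := fun w => by rw [hX, mem_filter]; simp only [mem_univ, true_and]
  have memY : ∀ w, w ∈ Y ↔ D.Adj u w := fun w => by rw [hY, mem_filter]; simp only [mem_univ, true_and]
  have memZ : ∀ w, w ∈ Z ↔ ¬ D.Adj v w ∧ ¬ D.Adj u w := fun w => by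
    rw [hZ, mem_filter]; simp only [mem_univ, true_and]
  have hXY : ∀ w, D.Adj v w → ¬ D.Adj u w := fun w hv hu => htri u v w huv hu hv
  have hXind : ∀ a b, D.Adj v a → D.Adj v b → ¬ D.Adj a b := fun a b ha hb hab => htri v a b ha hb hab
  have hYind : ∀ a b, D.Adj u a → D.Adj u b → ¬ D.Adj a b := fun a b ha hb hab => htri u a b ha hb hab
  have huX : u ∈ X := (memX u).mpr huv.symm
  have hvY : v ∈ Y := (memY v).mpr huv
  have hcard : X.card + Y.card + Z.card = Fintype.card V := by
    rw [hX, hY, hZ]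
    have h1 := card_filter_add_card_filter_not (s := (univ : Finset V)) (fun w => D.Adj v w)
    have h2 := card_filter_add_card_filter_not (s := univ.filter (fun w => ¬ D.Adj v w))
      (fun w => D.Adj u w)
    rw [filter_filter, filter_filter] at h2
    have e1 : (univ.filter (fun w => ¬ D.Adj v w ∧ D.Adj u w)) = univ.filter (fun w => D.Adj u w) := by
      ext w
      simp only [mem_filter, mem_univ, true_and]
      exact ⟨fun h => h.2, fun h => ⟨fun hv => hXY w hv h, h⟩⟩
    rw [e1] at h2
    rw [card_univ] at h1
    omega
  -- the four classes of ordered adjacent pairs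
  obtain ⟨A₁, hA₁⟩ : ∃ A₁ : Finset (V × V),
      A₁ = (adjPairsAll D).filter (fun p => D.Adj v p.1 ∧ D.Adj u p.2) := ⟨_, rfl⟩
  obtain ⟨A₃, hA₃⟩ : ∃ A₃ : Finset (V × V), A₃ = (adjPairsAll D).filter
      (fun p => (¬ D.Adj v p.1 ∧ ¬ D.Adj u p.1) ∧ (D.Adj v p.2 ∨ D.Adj u p.2)) := ⟨_, rfl⟩
  have memA₁ : ∀ p, p ∈ A₁ ↔ D.Adj p.1 p.2 ∧ D.Adj v p.1 ∧ D.Adj u p.2 := fun p => by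
    rw [hA₁, mem_filter, mem_adjPairsAll]
  have memA₃ : ∀ p, p ∈ A₃ ↔ D.Adj p.1 p.2 ∧ (¬ D.Adj v p.1 ∧ ¬ D.Adj u p.1) ∧
      (D.Adj v p.2 ∨ D.Adj u p.2) := fun p => by
    rw [hA₃, mem_filter, mem_adjPairsAll]
  have hsplit : 2 * ∑ p ∈ A₁, deficit D p + 2 * ∑ p ∈ A₃, deficit D p ≤
      ∑ p ∈ adjPairsAll D, deficit D p := by
    have h := sum_four_filters_le (adjPairsAll D) (deficit D)
      (fun p => D.Adj v p.1 ∧ D.Adj u p.2) (fun p => D.Adj u p.1 ∧ D.Adj v p.2)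
      (fun p => (¬ D.Adj v p.1 ∧ ¬ D.Adj u p.1) ∧ (D.Adj v p.2 ∨ D.Adj u p.2))
      (fun p => (D.Adj v p.1 ∨ D.Adj u p.1) ∧ (¬ D.Adj v p.2 ∧ ¬ D.Adj u p.2))
      (fun p h2 h1 => hXY p.1 h1.1 h2.1) (fun p h3 h1 => h3.1.1 h1.1) (fun p h3 h2 => h3.1.2 h2.1)
      (fun p h4 h1 => h4.2.2 h1.2) (fun p h4 h2 => h4.2.1 h2.2)
      (fun p h4 h3 => by rcases h4.1 with h | h; exact h3.1.1 h; exact h3.1.2 h)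
    have h12 := sum_deficit_filter_swap D (fun p : V × V => D.Adj u p.1 ∧ D.Adj v p.2)
      (fun p : V × V => D.Adj v p.1 ∧ D.Adj u p.2) (fun p => by simp only [Prod.fst_swap, Prod.snd_swap]; exact and_comm)
    have h34 := sum_deficit_filter_swap D
      (fun p : V × V => (D.Adj v p.1 ∨ D.Adj u p.1) ∧ (¬ D.Adj v p.2 ∧ ¬ D.Adj u p.2))
      (fun p : V × V => (¬ D.Adj v p.1 ∧ ¬ D.Adj u p.1) ∧ (D.Adj v p.2 ∨ D.Adj u p.2))
      (fun p => by simp only [Prod.fst_swap, Prod.snd_swap]; exact and_comm)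
    rw [h12, h34] at h
    rw [hA₁, hA₃]
    omega
  -- the pointwise bound on the class `X × Y`
  have hA1 : ∀ p ∈ A₁,
      (X.filter (fun w => ¬ D.Adj p.2 w)).card + (Y.filter (fun w => ¬ D.Adj p.1 w)).card +
        (Z.filter (fun w => ¬ D.Adj p.1 w ∧ ¬ D.Adj p.2 w)).card ≤ deficit D p := by
    intro p hp
    obtain ⟨_, hx, hy⟩ := (memA₁ p).mp hp
    unfold deficit
    have hsub : X.filter (fun w => ¬ D.Adj p.2 w) ∪ Y.filter (fun w => ¬ D.Adj p.1 w) ∪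
        Z.filter (fun w => ¬ D.Adj p.1 w ∧ ¬ D.Adj p.2 w) ⊆
          univ.filter (fun x => ¬ D.Adj p.1 x ∧ ¬ D.Adj p.2 x) := by
      intro w hw
      rw [mem_filter]
      refine ⟨mem_univ _, ?_⟩
      simp only [mem_union, mem_filter] at hw
      rcases hw with (⟨hw1, hw2⟩ | ⟨hw1, hw2⟩) | ⟨_, hw2⟩
      · exact ⟨hXind p.1 w hx ((memX w).mp hw1), hw2⟩
      · exact ⟨hw2, hYind p.2 w hy ((memY w).mp hw1)⟩
      · exact hw2
    have hd1 : Disjoint (X.filter (fun w => ¬ D.Adj p.2 w)) (Y.filter (fun w => ¬ D.Adj p.1 w)) := by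
      rw [disjoint_left]
      intro w hw1 hw2
      rw [mem_filter] at hw1 hw2
      exact hXY w ((memX w).mp hw1.1) ((memY w).mp hw2.1)
    have hd2 : Disjoint (X.filter (fun w => ¬ D.Adj p.2 w) ∪ Y.filter (fun w => ¬ D.Adj p.1 w))
        (Z.filter (fun w => ¬ D.Adj p.1 w ∧ ¬ D.Adj p.2 w)) := by
      rw [disjoint_left]
      intro w hw1 hw2
      rw [mem_filter] at hw2
      have hw2' := (memZ w).mp hw2.1
      simp only [mem_union, mem_filter] at hw1
      rcases hw1 with ⟨h, _⟩ | ⟨h, _⟩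
      · exact hw2'.1 ((memX w).mp h)
      · exact hw2'.2 ((memY w).mp h)
    have := card_le_card hsub
    rw [card_union_of_disjoint hd2, card_union_of_disjoint hd1] at this
    exact this
  -- the pointwise bound on the class `Z × (X ∪ Y)`
  have hA3 : ∀ p ∈ A₃, 1 ≤ deficit D p := by
    intro p hp
    obtain ⟨_, ⟨hz1, hz2⟩, hw⟩ := (memA₃ p).mp hp
    unfold deficit
    rw [Nat.one_le_iff_ne_zero, ne_eq, card_eq_zero, filter_eq_empty_iff]
    intro hall
    rcases hw with h | h
    · exact hall (mem_univ u) ⟨fun h' => hz2 h'.symm, fun h' => hXind p.2 u h huv.symm h'⟩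
    · exact hall (mem_univ v) ⟨fun h' => hz1 h'.symm, fun h' => hYind p.2 v h huv h'⟩
  -- the three pieces of the `X × Y` class
  have hA1sum : ∑ p ∈ A₁, (X.filter (fun w => ¬ D.Adj p.2 w)).card +
      ∑ p ∈ A₁, (Y.filter (fun w => ¬ D.Adj p.1 w)).card +
        ∑ p ∈ A₁, (Z.filter (fun w => ¬ D.Adj p.1 w ∧ ¬ D.Adj p.2 w)).card ≤
          ∑ p ∈ A₁, deficit D p := by
    rw [← sum_add_distrib, ← sum_add_distrib]
    exact sum_le_sum hA1
  have hA3sum : A₃.card ≤ ∑ p ∈ A₃, deficit D p := by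
    rw [card_eq_sum_ones]
    exact sum_le_sum hA3
  have hXY2 : 2 ≤ X.card + Y.card := by
    have := card_pos.mpr ⟨u, huX⟩
    have := card_pos.mpr ⟨v, hvY⟩
    omega
  by_cases hcase : ∃ x ∈ X, ∃ y ∈ Y, ¬ D.Adj x y
  · -- CASE 1: a non-adjacent pair `x₀ ∈ X`, `y₀ ∈ Y`
    obtain ⟨x₀, hx₀, y₀, hy₀, hxy⟩ := hcase
    have hx₀' := (memX x₀).mp hx₀
    have hy₀' := (memY y₀).mp hy₀
    -- the pairs `(x, y₀)`
    have hsub1 : (X.filter (fun x => D.Adj y₀ x)).image (fun x => (x, y₀)) ⊆ A₁ := by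
      intro p hp
      rw [mem_image] at hp
      obtain ⟨x, hx, rfl⟩ := hp
      rw [mem_filter] at hx
      exact (memA₁ _).mpr ⟨hx.2.symm, (memX x).mp hx.1, hy₀'⟩
    have hp1 : (X.filter (fun x => D.Adj y₀ x)).card * (X.filter (fun w => ¬ D.Adj y₀ w)).card ≤
        ∑ p ∈ A₁, (X.filter (fun w => ¬ D.Adj p.2 w)).card := by
      calc (X.filter (fun x => D.Adj y₀ x)).card * (X.filter (fun w => ¬ D.Adj y₀ w)).card
          = ∑ x ∈ X.filter (fun x => D.Adj y₀ x), (X.filter (fun w => ¬ D.Adj y₀ w)).card := by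
            rw [sum_const, smul_eq_mul]
        _ = ∑ p ∈ (X.filter (fun x => D.Adj y₀ x)).image (fun x => (x, y₀)),
              (X.filter (fun w => ¬ D.Adj p.2 w)).card := by
            rw [sum_image_pair_left]
        _ ≤ ∑ p ∈ A₁, (X.filter (fun w => ¬ D.Adj p.2 w)).card := sum_le_sum_of_subset hsub1
    have ht1 : 1 ≤ (X.filter (fun x => D.Adj y₀ x)).card :=
      card_pos.mpr ⟨u, by rw [mem_filter]; exact ⟨huX, hy₀'.symm⟩⟩
    have ht2 : 1 ≤ (X.filter (fun w => ¬ D.Adj y₀ w)).card :=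
      card_pos.mpr ⟨x₀, by rw [mem_filter]; exact ⟨hx₀, fun h => hxy h.symm⟩⟩
    have ht3 := card_filter_add_card_filter_not (s := X) (fun x => D.Adj y₀ x)
    -- the pairs `(x₀, y)`
    have hsub2 : (Y.filter (fun y => D.Adj x₀ y)).image (fun y => (x₀, y)) ⊆ A₁ := by
      intro p hp
      rw [mem_image] at hp
      obtain ⟨y, hy, rfl⟩ := hp
      rw [mem_filter] at hy
      exact (memA₁ _).mpr ⟨hy.2, hx₀', (memY y).mp hy.1⟩
    have hp2 : (Y.filter (fun y => D.Adj x₀ y)).card * (Y.filter (fun w => ¬ D.Adj x₀ w)).card ≤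
        ∑ p ∈ A₁, (Y.filter (fun w => ¬ D.Adj p.1 w)).card := by
      calc (Y.filter (fun y => D.Adj x₀ y)).card * (Y.filter (fun w => ¬ D.Adj x₀ w)).card
          = ∑ y ∈ Y.filter (fun y => D.Adj x₀ y), (Y.filter (fun w => ¬ D.Adj x₀ w)).card := by
            rw [sum_const, smul_eq_mul]
        _ = ∑ p ∈ (Y.filter (fun y => D.Adj x₀ y)).image (fun y => (x₀, y)),
              (Y.filter (fun w => ¬ D.Adj p.1 w)).card := by
            rw [sum_image_pair_right]
        _ ≤ ∑ p ∈ A₁, (Y.filter (fun w => ¬ D.Adj p.1 w)).card := sum_le_sum_of_subset hsub2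
    have hs1 : 1 ≤ (Y.filter (fun y => D.Adj x₀ y)).card :=
      card_pos.mpr ⟨v, by rw [mem_filter]; exact ⟨hvY, hx₀'.symm⟩⟩
    have hs2 : 1 ≤ (Y.filter (fun w => ¬ D.Adj x₀ w)).card :=
      card_pos.mpr ⟨y₀, by rw [mem_filter]; exact ⟨hy₀, hxy⟩⟩
    have hs3 := card_filter_add_card_filter_not (s := Y) (fun y => D.Adj x₀ y)
    -- the pair `(u, v)`
    have huvA : (u, v) ∈ A₁ := (memA₁ _).mpr ⟨huv, huv.symm, huv⟩
    have hp3 : Z.card ≤ ∑ p ∈ A₁, (Z.filter (fun w => ¬ D.Adj p.1 w ∧ ¬ D.Adj p.2 w)).card := by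
      have h := single_le_sum (f := fun p : V × V =>
        (Z.filter (fun w => ¬ D.Adj p.1 w ∧ ¬ D.Adj p.2 w)).card) (fun _ _ => Nat.zero_le _) huvA
      have e : Z.filter (fun w => ¬ D.Adj u w ∧ ¬ D.Adj v w) = Z := by
        apply filter_true_of_mem
        intro w hw
        rw [memZ] at hw
        exact ⟨hw.2, hw.1⟩
      rw [e] at h
      exact h
    have hm1 := mul_ge_add_sub_one _ _ ht1 ht2
    have hm2 := mul_ge_add_sub_one _ _ hs1 hs2
    omega
  · -- CASE 2 / 3: every `X`–`Y` pair is adjacent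
    have hall : ∀ x ∈ X, ∀ y ∈ Y, D.Adj x y := fun x hx y hy =>
      Classical.byContradiction (fun h => hcase ⟨x, hx, y, hy, h⟩)
    by_cases hZ0 : Z.card = 0
    · -- CASE 3: `Z = ∅`, the graph is `K_{X, Y}`
      exfalso
      apply hnot
      refine ⟨X, fun a b => ?_⟩
      have hZe : ∀ w, D.Adj v w ∨ D.Adj u w := by
        intro w
        by_contra hw
        have : w ∈ Z := (memZ w).mpr (not_or.mp hw)
        rw [card_eq_zero] at hZ0
        rw [hZ0] at this
        exact notMem_empty w this
      rw [memX, memX]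
      unfold Xor
      constructor
      · intro hab
        by_cases ha : D.Adj v a
        · by_cases hb : D.Adj v b
          · exact (hXind a b ha hb hab).elim
          · exact Or.inl ⟨ha, hb⟩
        · by_cases hb : D.Adj v b
          · exact Or.inr ⟨hb, ha⟩
          · have ha' := (hZe a).resolve_left ha
            have hb' := (hZe b).resolve_left hb
            exact (hYind a b ha' hb' hab).elim
      · rintro (⟨ha, hb⟩ | ⟨hb, ha⟩)
        · exact hall a ((memX a).mpr ha) b ((memY b).mpr ((hZe b).resolve_left hb))
        · exact (hall b ((memX b).mpr hb) a ((memY a).mpr ((hZe a).resolve_left ha))).symm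
    · -- CASE 2: `Z ≠ ∅`
      have hZ1 : 1 ≤ Z.card := Nat.one_le_iff_ne_zero.mpr hZ0
      -- per `z ∈ Z`: the far pairs of the `X × Y` class
      have hfar : ∀ z ∈ Z, (X.filter (fun x => ¬ D.Adj z x)).card * (Y.filter (fun y => ¬ D.Adj z y)).card ≤
          (A₁.filter (fun p => ¬ D.Adj p.1 z ∧ ¬ D.Adj p.2 z)).card := by
        intro z _
        rw [← card_product]
        apply card_le_card
        intro p hp
        simp only [mem_product, mem_filter] at hp
        rw [mem_filter, memA₁]
        exact ⟨⟨hall p.1 hp.1.1 p.2 hp.2.1, (memX p.1).mp hp.1.1, (memY p.2).mp hp.2.1⟩,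
          fun h => hp.1.2 h.symm, fun h => hp.2.2 h.symm⟩
      have hZsum : ∑ z ∈ Z,
          (X.filter (fun x => ¬ D.Adj z x)).card * (Y.filter (fun y => ¬ D.Adj z y)).card ≤
            ∑ p ∈ A₁, (Z.filter (fun w => ¬ D.Adj p.1 w ∧ ¬ D.Adj p.2 w)).card := by
        calc ∑ z ∈ Z, (X.filter (fun x => ¬ D.Adj z x)).card * (Y.filter (fun y => ¬ D.Adj z y)).card
            ≤ ∑ z ∈ Z, (A₁.filter (fun p => ¬ D.Adj p.1 z ∧ ¬ D.Adj p.2 z)).card := sum_le_sum hfar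
          _ = ∑ p ∈ A₁, (Z.filter (fun w => ¬ D.Adj p.1 w ∧ ¬ D.Adj p.2 w)).card := by
            simp only [card_filter]
            rw [sum_comm]
      -- per `z ∈ Z`: its edges into `X ∪ Y`
      have hA3card : ∑ z ∈ Z, ((X ∪ Y).filter (fun w => D.Adj z w)).card ≤ A₃.card := by
        have e : ∑ z ∈ Z, ((X ∪ Y).filter (fun w => D.Adj z w)).card =
            ((Z ×ˢ (X ∪ Y)).filter (fun p => D.Adj p.1 p.2)).card := by
          rw [card_filter, sum_product]
          apply sum_congr rfl
          intro z _
          rw [card_filter]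
        rw [e]
        apply card_le_card
        intro p hp
        simp only [mem_filter, mem_product, mem_union] at hp
        rw [memA₃]
        refine ⟨hp.2, (memZ p.1).mp hp.1.1, ?_⟩
        rcases hp.1.2 with h | h
        · exact Or.inl ((memX p.2).mp h)
        · exact Or.inr ((memY p.2).mp h)
      -- per `z ∈ Z`: `|X ∖ N(z)|·|Y ∖ N(z)| + |N(z) ∩ (X ∪ Y)| ≥ |X| + |Y| − 1`
      have hper : ∀ z ∈ Z, X.card + Y.card ≤
          (X.filter (fun x => ¬ D.Adj z x)).card * (Y.filter (fun y => ¬ D.Adj z y)).card +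
            ((X ∪ Y).filter (fun w => D.Adj z w)).card + 1 := by
        intro z hz
        have hz' := (memZ z).mp hz
        have hXYd : Disjoint X Y := by
          rw [disjoint_left]
          intro w hw1 hw2
          exact hXY w ((memX w).mp hw1) ((memY w).mp hw2)
        have hsplitXY : ((X ∪ Y).filter (fun w => D.Adj z w)).card =
            (X.filter (fun w => D.Adj z w)).card + (Y.filter (fun w => D.Adj z w)).card := by
          rw [filter_union, card_union_of_disjoint (disjoint_filter_filter hXYd)]
        have hXc := card_filter_add_card_filter_not (s := X) (fun w => D.Adj z w)
        have hYc := card_filter_add_card_filter_not (s := Y) (fun w => D.Adj z w)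
        have ha1 : 1 ≤ (X.filter (fun x => ¬ D.Adj z x)).card :=
          card_pos.mpr ⟨u, by rw [mem_filter]; exact ⟨huX, fun h => hz'.2 h.symm⟩⟩
        have hb1 : 1 ≤ (Y.filter (fun y => ¬ D.Adj z y)).card :=
          card_pos.mpr ⟨v, by rw [mem_filter]; exact ⟨hvY, fun h => hz'.1 h.symm⟩⟩
        rw [hsplitXY]
        -- `z` has neighbours on at most one side
        by_cases hside : ∃ y ∈ Y, D.Adj z y
        · obtain ⟨y, hy, hzy⟩ := hside
          have hnoX : (X.filter (fun w => D.Adj z w)).card = 0 := by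
            rw [card_eq_zero, filter_eq_empty_iff]
            intro x hx hzx
            exact htri z x y hzx hzy (hall x hx y hy)
          rw [hnoX]
          nlinarith [hXc, hYc, ha1, hb1]
        · have hnoY : (Y.filter (fun w => D.Adj z w)).card = 0 := by
            rw [card_eq_zero, filter_eq_empty_iff]
            exact fun y hy h => hside ⟨y, hy, h⟩
          rw [hnoY]
          nlinarith [hXc, hYc, ha1, hb1]
      have hsumper : Z.card * (X.card + Y.card) ≤ ∑ z ∈ Z,
          ((X.filter (fun x => ¬ D.Adj z x)).card * (Y.filter (fun y => ¬ D.Adj z y)).card +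
            ((X ∪ Y).filter (fun w => D.Adj z w)).card + 1) := by
        rw [← smul_eq_mul, ← sum_const]
        exact sum_le_sum hper
      rw [sum_add_distrib, sum_add_distrib, sum_const, smul_eq_mul, mul_one] at hsumper
      obtain ⟨j, hj⟩ : ∃ j, Fintype.card V = j + 2 := ⟨Fintype.card V - 2, by omega⟩
      rw [hj] at hcard
      rw [hj, Nat.add_sub_cancel]
      obtain ⟨z', hz'⟩ : ∃ z', Z.card = z' + 1 := ⟨Z.card - 1, by omega⟩
      obtain ⟨s', hs'⟩ : ∃ s', X.card + Y.card = s' + 2 := ⟨X.card + Y.card - 2, by omega⟩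
      rw [hz', hs'] at hsumper
      have hexp : (z' + 1) * (s' + 2) = z' * s' + 2 * z' + s' + 2 := by ring
      rw [hexp] at hsumper
      have hj' : j = s' + z' + 1 := by omega
      rw [hj']
      omega

/-- **MANTEL'S DEGREE-SUM LEMMA IS STABLE:** a triangle-free graph on `k` vertices with `m` edges that is not
complete bipartite spanning has `Σ_v d(v)² + (k − 2) ≤ m·k`. -/
theorem mantel_stability (D : SimpleGraph V) [DecidableRel D.Adj] (hfree : D.CliqueFree 3)
    (hnot : ¬ ∃ A : Finset V, ∀ x y, D.Adj x y ↔ Xor (x ∈ A) (y ∈ A)) :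
    ∑ v, deg D v * deg D v + (Fintype.card V - 2) ≤ D.edgeFinset.card * Fintype.card V := by
  have hE : ∃ u v, D.Adj u v := by
    by_contra hE
    apply hnot
    refine ⟨∅, fun x y => ?_⟩
    simp only [notMem_empty]
    unfold Xor
    simp only [false_and, or_self, iff_false]
    exact fun h => hE ⟨x, y, h⟩
  obtain ⟨u, v, huv⟩ := hE
  have h1 := two_mul_le_sum_deficit D hfree huv hnot
  have h2 := two_mul_sum_deg_sq_add_sum_deficit D
  rw [card_triangles3_eq_zero_of_cliqueFree D hfree] at h2
  linarith

/-- The cherry form: `2·Σ_v C(d(v), 2) + 2m + (k − 2) ≤ m·k` on a triangle-free graph that is not complete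
bipartite spanning. -/
theorem mantel_stability_cherries (D : SimpleGraph V) [DecidableRel D.Adj] (hfree : D.CliqueFree 3)
    (hnot : ¬ ∃ A : Finset V, ∀ x y, D.Adj x y ↔ Xor (x ∈ A) (y ∈ A)) :
    2 * cherries D + 2 * D.edgeFinset.card + (Fintype.card V - 2) ≤
      D.edgeFinset.card * Fintype.card V := by
  have h := mantel_stability D hfree hnot
  rw [← two_mul_cherries_add, sum_deg_eq] at h
  exact h

end C047

end TriangleCap

end PercRepro
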